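import Literature.NumberTheory.EllipticCurves.HeegnerPointsKolyvaginEulerSystem
import HarnessLib

/-!
# Route `KolyvaginRoadThree` — PARITY of Kolyvagin's classes when `p ∣ y_K`
# (`--supports stmt-BirchSwinnertonDyer-19574`, helper; cell `bsd-stepL`, seat `bsd-stepL-koly` g10)

THEOREMS ONLY (pure Galois-cohomology bookkeeping on Gross's Props. 5.4 (2) and 6.2; no new definition, no
named fact consumed). For a family of classes `cl : ℕ → H¹(K, E[p])` with the three printed properties of
Kolyvagin's classes `c(n)` (Gross 1991, Prop. 5.4 (2): `τ c(n) = ε(-1)^{f_n} c(n)`; Prop. 6.2 (1): `d(n)_v = 0`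
off `n`; Prop. 6.2 (2): `d(ℓm)_λ = 0 ⟺ c(m)_λ = 0`) — VERBATIM the output shape of the tree's named fact
`Gross1991_kolyvaginClasses N W K` — and with `cl 1 = δ P` the Kummer class of the Heegner point `P = y_K`:

* `levelOne_mem_selmerGroup_of_dvd`: if `p ∣ P` in `E(K)` (so `δ P = 0`, i.e. `p ∣ [E(K) : ℤ y_K]` when
  `E(K)[p] = 0`), then EVERY first derived class `cl ℓ` (`ℓ` a Kolyvagin prime) lies in the Selmer group
  `Sel_p(E/K)` and in the `(-ε)`-eigenspace of complex conjugation — the eigenspace OPPOSITE to `δ y_K`'s;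
* `levelOne_eq_zero_of_dvd_of_eigenSelmer_trivial`: hence if `Sel_p(E/K)^{-ε} = 0` every `cl ℓ` vanishes;
* `levelTwo_mem_selmerGroup_of_levelOne_eq_zero`: and then every second derived class `cl (ℓℓ')` lies in
  `Sel_p(E/K)^{ε}`;
* `mem_selmerGroup_of_divisors_eq_zero`, `exists_primeFactor_ne_zero_of_odd_of_eigenSelmer_trivial`: at any
  square-free Kolyvagin-supported level `n`, if the classes at the divisors `n/ℓ` vanish then `cl n` is a Selmer
  class with sign `ε(-1)^{ω(n)}`; consequently, when `Sel_p(E/K)^{-ε} = 0`, a non-zero class at an ODD level has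
  a non-zero class one level below — THE LEAST WITNESSING LEVEL OF KOLYVAGIN'S CONJECTURE MOD `p` IS EVEN
  (and `≥ 2` when `p ∣ y_K`).

Use at `p = 3`, `3 ∥ N` (memo `koly/MEMO-v7-PARITY.md`): on a Hoffstein–Luo pair `(E, K)` of the crux
`ZhangSharpFrameAtThreeHL` the Heegner point has `ε = +1` (`y_K ∈ E(ℚ) ⊗ ℤ₍₃₎`) and `3 ∣ I_K` on every TRUE-OPEN A1
row (x11b3 `E-K6`: `ord₃ I_K ≥ 1` on 1 081 ∕ 1 081), so every level-1 witness of Kolyvagin's conjecture mod 3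
lives in `Sel₃(E/K)^- ≅ Sel₃(E^{d_K}/ℚ)`; on the 34 `Ш_an(E) = 9` rows (x11b3 `PREDICTIONS-KOLY2` stratum S-A,
where `Ш(E^{d_K})[3] = 0`) NO level-1 witness exists and the first non-zero class has `ω(n)` even — the kit
computation j250734 (`P(2) ∈ 3E(K[2])` exactly at 460023a1 ⊗ ℚ(√−11)) is the first numerical instance.
Nothing is asserted about the crux; no class of atom O2@3 moves (PARTITION: O2@3 × A1 — types-the-object-of;
closes: none). References: [GrossLMS1991] §§4–6, Props. 5.4 (2), 6.2, §10 Prop. 10.2; [McCallumLMS1991] §5.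
-/

noncomputable section

open scoped Classical

universe u

namespace Summit.BirchSwinnertonDyer.BirchSwinnertonDyer.Theorems.KolyParity

open WeierstrassCurve NumberField IsDedekindDomain Literature.NumberTheory.EllipticCurves

variable {N : ℕ} {W : WeierstrassCurve ℚ} {K : Type u} [Field K] [NumberField K]

/-- **`δ P = 0` when `p ∣ P` in `E(K)`** (exactness of the Kummer sequence at `E(K)/pE(K)`: the kernel of
the Kummer map is `pE(K)`, tree `kummerMapTorsion_ker`; Gross 1991, §2, (2.2)). [cite: GrossLMS1991, §2 (2.2)] -/
theorem kummerClassOfPoint_eq_zero_of_dvd {p : ℕ} (hp : p.Prime) {P : (W.baseChange K).toAffine.Point}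
    (hdiv : ∃ Q : (W.baseChange K).toAffine.Point, p • Q = P) : kummerClassOfPoint W K hp P = 0 := by
  obtain ⟨Q, hQ⟩ := hdiv
  have hker : P ∈ (kummerMapTorsion (W.baseChange K) p
      ((W.baseChange K).zsmul_geomPoints_surjective_of_charZero (by exact_mod_cast hp.ne_zero))).ker := by
    rw [kummerMapTorsion_ker]
    exact ⟨Q, by rw [← hQ, ← natCast_zsmul]; rfl⟩
  exact hker

/-- **Level 1: when `p ∣ y_K`, every first derived class is a SELMER class in the `(-ε)`-eigenspace.**
For a family `cl` with Gross's Props. 5.4 (2) ∕ 6.2 (the hypothesis `hcl`, verbatim the output of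
`Gross1991_kolyvaginClasses N W K`) and `cl 1 = δ P`: if `p ∣ P` in `E(K)` then for every Kolyvagin prime `ℓ`
the class `cl ℓ` satisfies every local Selmer condition (off `λ` by Prop. 6.2 (1); at `λ` by Prop. 6.2 (2),
since `c(1)_λ = (δ P)_λ = 0`) and `τ (cl ℓ) = -ε · cl ℓ` (Prop. 5.4 (2), `f_ℓ = 1`) — Gross's Prop. 10.2
(6) ⟹ «`c(ℓ) ∈ Sel(E/K)_p^{-ε}`», here in the degenerate case `δ y_K = 0` that §10 excludes.
[cite: GrossLMS1991, Prop. 5.4 (2), Prop. 6.2, Prop. 10.2] -/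
theorem levelOne_mem_selmerGroup_of_dvd {p : ℕ} (hp : p.Prime) (c : K ≃ₐ[ℚ] K) {ε : ℤ}
    {cl : ℕ → galH1Torsion (W.baseChange K) p} {P : (W.baseChange K).toAffine.Point}
    (hc1 : cl 1 = kummerClassOfPoint W K hp P)
    (hcl : ∀ n : ℕ, Squarefree n → (∀ q ∈ n.primeFactors, IsKolyvaginPrime N W K p q) →
      conjAct W c p (cl n) = (ε * (-1) ^ n.primeFactors.card) • cl n ∧
      (∀ v : HeightOneSpectrum (𝓞 K), (n : 𝓞 K) ∉ v.asIdeal →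
        cl n ∈ selmerLocalKer (W.baseChange K) (v.adicCompletion K) p) ∧
      (∀ w : InfinitePlace K, cl n ∈ selmerLocalKer (W.baseChange K) w.Completion p) ∧
      (∀ ℓ : ℕ, ℓ.Prime → ℓ ∣ n → ∀ v : HeightOneSpectrum (𝓞 K), (ℓ : 𝓞 K) ∈ v.asIdeal →
        (cl n ∈ selmerLocalKer (W.baseChange K) (v.adicCompletion K) p ↔
          cl (n / ℓ) ∈ (W.baseChange K).torsionLocalKer (v.adicCompletion K) p)))
    (hdiv : ∃ Q : (W.baseChange K).toAffine.Point, p • Q = P)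
    {ℓ : ℕ} (hℓ : IsKolyvaginPrime N W K p ℓ) :
    cl ℓ ∈ selmerGroup (W.baseChange K) p ∧ conjAct W c p (cl ℓ) = (-ε) • cl ℓ := by
  have h1 : cl 1 = 0 := by rw [hc1, kummerClassOfPoint_eq_zero_of_dvd hp hdiv]
  have hsf : Squarefree ℓ := hℓ.prime.squarefree
  have hpf : ∀ q ∈ ℓ.primeFactors, IsKolyvaginPrime N W K p q := fun q hq ↦ by
    rw [hℓ.prime.primeFactors, Finset.mem_singleton] at hq
    exact hq ▸ hℓ
  obtain ⟨hτ, hfin, hinf, hat⟩ := hcl ℓ hsf hpf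
  refine ⟨(mem_selmerGroup_iff _ _ _).mpr ⟨fun v ↦ ?_, hinf⟩, ?_⟩
  · by_cases hv : (ℓ : 𝓞 K) ∈ v.asIdeal
    · refine (hat ℓ hℓ.prime dvd_rfl v hv).mpr ?_
      rw [Nat.div_self hℓ.prime.pos, h1]
      exact AddSubgroup.zero_mem _
    · exact hfin v hv
  · rw [hτ, KolyvaginDescent.card_primeFactors_prime hℓ.prime, pow_one, mul_neg_one]

/-- **Level 1, vanishing: if moreover `Sel_p(E/K)^{-ε} = 0`, every first derived class VANISHES.**
(On a pair with `r_an(E/ℚ) = 1`, `r_an(E^{d_K}/ℚ) = 0` one has `ε = +1` and, `p` odd,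
`Sel_p(E/K)^- ≅ Sel_p(E^{d_K}/ℚ)`, which is `0` as soon as `E^{d_K}(ℚ)[p] = 0` and `Ш(E^{d_K}/ℚ)[p] = 0` —
memo `MEMO-v7-PARITY.md` §2; the hypothesis is carried here as the shape `hSel`.)
[cite: GrossLMS1991, Prop. 10.2 and Claim 10.1 (shape)] -/
theorem levelOne_eq_zero_of_dvd_of_eigenSelmer_trivial {p : ℕ} (hp : p.Prime) (c : K ≃ₐ[ℚ] K) {ε : ℤ}
    {cl : ℕ → galH1Torsion (W.baseChange K) p} {P : (W.baseChange K).toAffine.Point}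
    (hc1 : cl 1 = kummerClassOfPoint W K hp P)
    (hcl : ∀ n : ℕ, Squarefree n → (∀ q ∈ n.primeFactors, IsKolyvaginPrime N W K p q) →
      conjAct W c p (cl n) = (ε * (-1) ^ n.primeFactors.card) • cl n ∧
      (∀ v : HeightOneSpectrum (𝓞 K), (n : 𝓞 K) ∉ v.asIdeal →
        cl n ∈ selmerLocalKer (W.baseChange K) (v.adicCompletion K) p) ∧
      (∀ w : InfinitePlace K, cl n ∈ selmerLocalKer (W.baseChange K) w.Completion p) ∧
      (∀ ℓ : ℕ, ℓ.Prime → ℓ ∣ n → ∀ v : HeightOneSpectrum (𝓞 K), (ℓ : 𝓞 K) ∈ v.asIdeal →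
        (cl n ∈ selmerLocalKer (W.baseChange K) (v.adicCompletion K) p ↔
          cl (n / ℓ) ∈ (W.baseChange K).torsionLocalKer (v.adicCompletion K) p)))
    (hdiv : ∃ Q : (W.baseChange K).toAffine.Point, p • Q = P)
    (hSel : ∀ s ∈ selmerGroup (W.baseChange K) p, conjAct W c p s = (-ε) • s → s = 0)
    {ℓ : ℕ} (hℓ : IsKolyvaginPrime N W K p ℓ) : cl ℓ = 0 := by
  obtain ⟨hmem, hτ⟩ := levelOne_mem_selmerGroup_of_dvd hp c hc1 hcl hdiv hℓ
  exact hSel _ hmem hτ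

/-- **Level 2: when the first derived classes at `ℓ ≠ ℓ'` vanish, the second derived class `cl (ℓℓ')` is a
SELMER class in the `ε`-eigenspace** (Prop. 6.2 (1) off `λ, λ'`; Prop. 6.2 (2) at `λ` with `c(ℓ')_λ = 0`
and at `λ'` with `c(ℓ)_{λ'} = 0`; Prop. 5.4 (2) with `f_{ℓℓ'} = 2`). With the two previous theorems: when
`p ∣ y_K` and `Sel_p(E/K)^{-ε} = 0`, Kolyvagin's conjecture mod `p` can only be witnessed at a level `n` with
`ω(n) ≥ 2`, and every level-2 class is a Selmer class on `δ y_K`'s own side.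
[cite: GrossLMS1991, Prop. 5.4 (2), Prop. 6.2] -/
theorem levelTwo_mem_selmerGroup_of_levelOne_eq_zero {p : ℕ} (c : K ≃ₐ[ℚ] K) {ε : ℤ}
    {cl : ℕ → galH1Torsion (W.baseChange K) p}
    (hcl : ∀ n : ℕ, Squarefree n → (∀ q ∈ n.primeFactors, IsKolyvaginPrime N W K p q) →
      conjAct W c p (cl n) = (ε * (-1) ^ n.primeFactors.card) • cl n ∧
      (∀ v : HeightOneSpectrum (𝓞 K), (n : 𝓞 K) ∉ v.asIdeal →
        cl n ∈ selmerLocalKer (W.baseChange K) (v.adicCompletion K) p) ∧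
      (∀ w : InfinitePlace K, cl n ∈ selmerLocalKer (W.baseChange K) w.Completion p) ∧
      (∀ ℓ : ℕ, ℓ.Prime → ℓ ∣ n → ∀ v : HeightOneSpectrum (𝓞 K), (ℓ : 𝓞 K) ∈ v.asIdeal →
        (cl n ∈ selmerLocalKer (W.baseChange K) (v.adicCompletion K) p ↔
          cl (n / ℓ) ∈ (W.baseChange K).torsionLocalKer (v.adicCompletion K) p)))
    {ℓ ℓ' : ℕ} (hℓ : IsKolyvaginPrime N W K p ℓ) (hℓ' : IsKolyvaginPrime N W K p ℓ') (hne : ℓ ≠ ℓ')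
    (h0 : cl ℓ = 0) (h0' : cl ℓ' = 0) :
    cl (ℓ * ℓ') ∈ selmerGroup (W.baseChange K) p ∧ conjAct W c p (cl (ℓ * ℓ')) = ε • cl (ℓ * ℓ') := by
  have hsf : Squarefree (ℓ * ℓ') := by
    rw [Nat.squarefree_mul_iff]
    exact ⟨(Nat.coprime_primes hℓ.prime hℓ'.prime).mpr hne, hℓ.prime.squarefree, hℓ'.prime.squarefree⟩
  have hpf : ∀ q ∈ (ℓ * ℓ').primeFactors, IsKolyvaginPrime N W K p q := fun q hq ↦ by
    rw [Nat.primeFactors_mul hℓ.prime.ne_zero hℓ'.prime.ne_zero, Finset.mem_union, hℓ.prime.primeFactors,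
      hℓ'.prime.primeFactors, Finset.mem_singleton, Finset.mem_singleton] at hq
    rcases hq with rfl | rfl
    · exact hℓ
    · exact hℓ'
  obtain ⟨hτ, hfin, hinf, hat⟩ := hcl (ℓ * ℓ') hsf hpf
  refine ⟨(mem_selmerGroup_iff _ _ _).mpr ⟨fun v ↦ ?_, hinf⟩, ?_⟩
  · by_cases hv : ((ℓ * ℓ' : ℕ) : 𝓞 K) ∈ v.asIdeal
    · rcases natCast_mul_mem_asIdeal (K := K) hv with h | h
      · refine (hat ℓ hℓ.prime (dvd_mul_right ℓ ℓ') v h).mpr ?_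
        rw [Nat.mul_div_cancel_left ℓ' hℓ.prime.pos, h0']
        exact AddSubgroup.zero_mem _
      · refine (hat ℓ' hℓ'.prime (dvd_mul_left ℓ' ℓ) v h).mpr ?_
        rw [Nat.mul_div_cancel ℓ hℓ'.prime.pos, h0]
        exact AddSubgroup.zero_mem _
    · exact hfin v hv
  · rw [hτ, KolyvaginDescent.card_primeFactors_mul hℓ.prime hℓ'.prime hne, even_two.neg_pow, one_pow,
      mul_one]

/-- **Summary (the parity law at levels ≤ 2).** Under Gross's Props. 5.4 (2) ∕ 6.2 for the family `cl` with
`cl 1 = δ P`: if `p ∣ P` in `E(K)` and `Sel_p(E/K)^{-ε} = 0`, then (i) `cl ℓ = 0` for every Kolyvagin prime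
`ℓ` — there is NO level-1 witness of Kolyvagin's conjecture mod `p` — and (ii) every level-2 class
`cl (ℓℓ')` (`ℓ ≠ ℓ'`) is a Selmer class with `τ cl(ℓℓ') = ε cl(ℓℓ')`.
[cite: GrossLMS1991, Props. 5.4 (2), 6.2, 10.2] [cite: McCallumLMS1991, §5 (structure of Ш, shape)] -/
theorem parity_of_dvd_of_eigenSelmer_trivial {p : ℕ} (hp : p.Prime) (c : K ≃ₐ[ℚ] K) {ε : ℤ}
    {cl : ℕ → galH1Torsion (W.baseChange K) p} {P : (W.baseChange K).toAffine.Point}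
    (hc1 : cl 1 = kummerClassOfPoint W K hp P)
    (hcl : ∀ n : ℕ, Squarefree n → (∀ q ∈ n.primeFactors, IsKolyvaginPrime N W K p q) →
      conjAct W c p (cl n) = (ε * (-1) ^ n.primeFactors.card) • cl n ∧
      (∀ v : HeightOneSpectrum (𝓞 K), (n : 𝓞 K) ∉ v.asIdeal →
        cl n ∈ selmerLocalKer (W.baseChange K) (v.adicCompletion K) p) ∧
      (∀ w : InfinitePlace K, cl n ∈ selmerLocalKer (W.baseChange K) w.Completion p) ∧
      (∀ ℓ : ℕ, ℓ.Prime → ℓ ∣ n → ∀ v : HeightOneSpectrum (𝓞 K), (ℓ : 𝓞 K) ∈ v.asIdeal →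
        (cl n ∈ selmerLocalKer (W.baseChange K) (v.adicCompletion K) p ↔
          cl (n / ℓ) ∈ (W.baseChange K).torsionLocalKer (v.adicCompletion K) p)))
    (hdiv : ∃ Q : (W.baseChange K).toAffine.Point, p • Q = P)
    (hSel : ∀ s ∈ selmerGroup (W.baseChange K) p, conjAct W c p s = (-ε) • s → s = 0) :
    (∀ ℓ, IsKolyvaginPrime N W K p ℓ → cl ℓ = 0) ∧
      ∀ ℓ ℓ', IsKolyvaginPrime N W K p ℓ → IsKolyvaginPrime N W K p ℓ' → ℓ ≠ ℓ' →
        cl (ℓ * ℓ') ∈ selmerGroup (W.baseChange K) p ∧ conjAct W c p (cl (ℓ * ℓ')) = ε • cl (ℓ * ℓ') :=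
  ⟨fun _ hℓ ↦ levelOne_eq_zero_of_dvd_of_eigenSelmer_trivial hp c hc1 hcl hdiv hSel hℓ,
    fun _ _ hℓ hℓ' hne ↦ levelTwo_mem_selmerGroup_of_levelOne_eq_zero c hcl hℓ hℓ' hne
      (levelOne_eq_zero_of_dvd_of_eigenSelmer_trivial hp c hc1 hcl hdiv hSel hℓ)
      (levelOne_eq_zero_of_dvd_of_eigenSelmer_trivial hp c hc1 hcl hdiv hSel hℓ')⟩

/-! ## All levels: the least witnessing level is EVEN -/

/-- Prime factors of `n / ℓ` for a square-free `n` and a prime `ℓ ∣ n`: `n.primeFactors` with `ℓ` erased.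
[folklore] -/
theorem primeFactors_div_of_squarefree {n ℓ : ℕ} (hn : Squarefree n) (hℓ : ℓ ∈ n.primeFactors) :
    (n / ℓ).primeFactors = n.primeFactors.erase ℓ := by
  have hℓp : ℓ.Prime := Nat.prime_of_mem_primeFactors hℓ
  have hdvd : ℓ ∣ n := Nat.dvd_of_mem_primeFactors hℓ
  have hm0 : n / ℓ ≠ 0 := by
    intro h
    exact hn.ne_zero (by rw [← Nat.mul_div_cancel' hdvd, h, mul_zero])
  have hnd : ℓ ∉ (n / ℓ).primeFactors := by
    intro h
    have h2 : ℓ * ℓ ∣ n := by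
      have := Nat.mul_dvd_mul_left ℓ (Nat.dvd_of_mem_primeFactors h)
      rwa [Nat.mul_div_cancel' hdvd] at this
    exact hℓp.one_lt.ne' (Nat.isUnit_iff.mp (hn ℓ h2))
  have hmul : n.primeFactors = insert ℓ (n / ℓ).primeFactors := by
    conv_lhs => rw [← Nat.mul_div_cancel' hdvd]
    rw [Nat.primeFactors_mul hℓp.ne_zero hm0, hℓp.primeFactors]
    rfl
  rw [hmul, Finset.erase_insert hnd]

/-- **Any level: if every class one level below `n` (at the divisors `n/ℓ`) vanishes, `cl n` is a SELMER class
with `τ cl n = ε(-1)^{ω(n)} cl n`** (Prop. 6.2 (1) off `n`; Prop. 6.2 (2) at each `λ ∣ n` with `c(n/ℓ)_λ = 0`;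
a finite place containing the square-free `n = ∏ ℓ` contains one of its prime factors; Prop. 5.4 (2)).
[cite: GrossLMS1991, Prop. 5.4 (2), Prop. 6.2] -/
theorem mem_selmerGroup_of_divisors_eq_zero {p : ℕ} (c : K ≃ₐ[ℚ] K) {ε : ℤ}
    {cl : ℕ → galH1Torsion (W.baseChange K) p}
    (hcl : ∀ n : ℕ, Squarefree n → (∀ q ∈ n.primeFactors, IsKolyvaginPrime N W K p q) →
      conjAct W c p (cl n) = (ε * (-1) ^ n.primeFactors.card) • cl n ∧
      (∀ v : HeightOneSpectrum (𝓞 K), (n : 𝓞 K) ∉ v.asIdeal →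
        cl n ∈ selmerLocalKer (W.baseChange K) (v.adicCompletion K) p) ∧
      (∀ w : InfinitePlace K, cl n ∈ selmerLocalKer (W.baseChange K) w.Completion p) ∧
      (∀ ℓ : ℕ, ℓ.Prime → ℓ ∣ n → ∀ v : HeightOneSpectrum (𝓞 K), (ℓ : 𝓞 K) ∈ v.asIdeal →
        (cl n ∈ selmerLocalKer (W.baseChange K) (v.adicCompletion K) p ↔
          cl (n / ℓ) ∈ (W.baseChange K).torsionLocalKer (v.adicCompletion K) p)))
    {n : ℕ} (hn : Squarefree n) (hK : ∀ q ∈ n.primeFactors, IsKolyvaginPrime N W K p q)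
    (h0 : ∀ ℓ ∈ n.primeFactors, cl (n / ℓ) = 0) :
    cl n ∈ selmerGroup (W.baseChange K) p ∧
      conjAct W c p (cl n) = (ε * (-1) ^ n.primeFactors.card) • cl n := by
  obtain ⟨hτ, hfin, hinf, hat⟩ := hcl n hn hK
  refine ⟨(mem_selmerGroup_iff _ _ _).mpr ⟨fun v ↦ ?_, hinf⟩, hτ⟩
  by_cases hv : (n : 𝓞 K) ∈ v.asIdeal
  · have hprod : ((∏ q ∈ n.primeFactors, q : ℕ) : 𝓞 K) ∈ v.asIdeal := by
      rwa [Nat.prod_primeFactors_of_squarefree hn]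
    rw [Nat.cast_prod] at hprod
    obtain ⟨ℓ, hℓn, hℓv⟩ := (Ideal.IsPrime.prod_mem_iff (hp := v.isPrime)).mp hprod
    refine (hat ℓ (Nat.prime_of_mem_primeFactors hℓn) (Nat.dvd_of_mem_primeFactors hℓn) v hℓv).mpr ?_
    rw [h0 ℓ hℓn]
    exact AddSubgroup.zero_mem _
  · exact hfin v hv

/-- **The least witnessing level is even.** Under Gross's Props. 5.4 (2) ∕ 6.2 for `cl` and
`Sel_p(E/K)^{-ε} = 0`: a non-zero class `cl n ≠ 0` at a square-free Kolyvagin-supported `n` with `ω(n)` ODD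
has a non-zero class one level below it, `cl (n/ℓ) ≠ 0` for some prime `ℓ ∣ n` (else `cl n` would be a Selmer
class with `τ cl n = -ε cl n`, hence `0`). So the least `ω(n)` with `cl n ≠ 0`, if any, is EVEN; with
`p ∣ y_K` (`cl 1 = δ y_K = 0`) it is an even number `≥ 2`.
[cite: GrossLMS1991, Props. 5.4 (2), 6.2, 10.2] [cite: McCallumLMS1991, §5 (structure of Ш, shape)] -/
theorem exists_primeFactor_ne_zero_of_odd_of_eigenSelmer_trivial {p : ℕ} (c : K ≃ₐ[ℚ] K) {ε : ℤ}
    {cl : ℕ → galH1Torsion (W.baseChange K) p}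
    (hcl : ∀ n : ℕ, Squarefree n → (∀ q ∈ n.primeFactors, IsKolyvaginPrime N W K p q) →
      conjAct W c p (cl n) = (ε * (-1) ^ n.primeFactors.card) • cl n ∧
      (∀ v : HeightOneSpectrum (𝓞 K), (n : 𝓞 K) ∉ v.asIdeal →
        cl n ∈ selmerLocalKer (W.baseChange K) (v.adicCompletion K) p) ∧
      (∀ w : InfinitePlace K, cl n ∈ selmerLocalKer (W.baseChange K) w.Completion p) ∧
      (∀ ℓ : ℕ, ℓ.Prime → ℓ ∣ n → ∀ v : HeightOneSpectrum (𝓞 K), (ℓ : 𝓞 K) ∈ v.asIdeal →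
        (cl n ∈ selmerLocalKer (W.baseChange K) (v.adicCompletion K) p ↔
          cl (n / ℓ) ∈ (W.baseChange K).torsionLocalKer (v.adicCompletion K) p)))
    (hSel : ∀ s ∈ selmerGroup (W.baseChange K) p, conjAct W c p s = (-ε) • s → s = 0)
    {n : ℕ} (hn : Squarefree n) (hK : ∀ q ∈ n.primeFactors, IsKolyvaginPrime N W K p q)
    (hodd : Odd n.primeFactors.card) (hne : cl n ≠ 0) :
    ∃ ℓ ∈ n.primeFactors, cl (n / ℓ) ≠ 0 := by
  by_contra hall
  push Not at hall
  obtain ⟨hmem, hτ⟩ := mem_selmerGroup_of_divisors_eq_zero c hcl hn hK hall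
  rw [hodd.neg_one_pow, mul_neg_one] at hτ
  exact hne (hSel _ hmem hτ)

end Summit.BirchSwinnertonDyer.BirchSwinnertonDyer.Theorems.KolyParity

end
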